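import Literature.Computability.AlgebraicComplexity.MS21UniformSVGenerator
import Literature.Computability.AlgebraicComplexity.MS21SigmaPiSigmaCoefficientMap
import Literature.Computability.AlgebraicComplexity.MS21SparseOrbitHittingProofs
import HarnessLib

/-!
# Medini–Shpilka 2021, Cor 44 AS TYPED (existence and size of hitting sets for the orbits of
# sparse polynomials) — discharge of `MS2021_cor_44`

The named fact `MS2021_cor_44` of `MS21DenseOrbitsHittingSets.lean` types MS Cor 44 (CCC 2021,
LIPIcs 200:19, p.19:14 = arXiv:2102.05632 ‹Cor 1.27›) in EXISTENCE-AND-SIZE form ("explicit" was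
dropped when typing, flagged WEAKER there): one constant `c` such that over every field with
`|F| > n·d` (or infinite) some set of at most `(n·d)^{c(⌊log₂ s⌋+1)} + c` points hits every nonzero
member of `(Σ^{[s]}Π^{[d]})^{GLaff_n(F)}` (`MS2021.sparseAffOrbits n s d`, the affine orbits of the
`s`-sparse polynomials of degree `≤ d`).

This file proves it BY NAME, `MS2021_cor_44_holds : MS2021_cor_44`, with `c = 12`, by the cell's
coefficient-cover route (lead-np RULINGS (52)–(55), 2026-08-27): a member `g(Ax+b)` of the class is
computed by a `Σ^{[s]}Π^{[d+1]}Σ` circuit (`MS2021.isSPS_aeval_affine`, seat x6 — "Clearly,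
`T_{s,d}^{GLaff_n} ⊂ Σ^{[s]}Π^{[d]}Σ`", CCC p.19:13) and has degree `≤ d`, so the Heintz–Schnorr
type coefficient cover for `Σ^{[s]}Π^{[d+1]}Σ` (`MS2021.SPSCoeff.exists_hittingSet_isSPS`, seat p2,
on a grid `S ⊆ F` with `|S| = 2d ≤ n·d < |F|`, `n ≥ 2`) gives a hitting set of at most
`s·((d+1)(n+1))·(log₂((2d)ⁿ(d+1)+1)+1)+1 ≤ (nd)^{⌊log₂ s⌋+9}+1 ≤ (nd)^{12(⌊log₂ s⌋+1)}+12` points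
(`MS2021.cor44_coeffCover_bound`); the rows `d = 0`, `n = 0`, `n = 1` use the identity map as a
generator on the grids `{0}^n` / `W¹`, `|W| = d+1` (Obs 18, `MS2021.isHittingSetFor_image_piFinset`).
DISCLOSED DEVIATION: existence by parametrisation + coefficient cover, not the printed explicit
generator route "(cor:hs-sparse) follows immediately from (thm:PITSINV) and (obsHitSetGen)"
(arXiv p0035:L5) — that route is the tree's conditional edge `MS2021_cor_44_of_thm_43`
(`MS21UniformSVGenerator.lean`), which yields the same named fact from `MS2021_thm_43` — and,
now that `MS2021_thm_43_holds` is in the tree (`MS21SparseOrbitHittingProofs.lean`, seat p1), the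
PRINTED-ROUTE proof `MS2021_cor_44_holds_printed` (v2 of this file; both proofs are kept).

Theorem-only file: no definition, no new named fact (D-0026), no `instance`, no `notation`; net
debt `−1`. HONEST FRAMING: literature hygiene — an existence-form typed corollary becomes a theorem
of the tree; `VP ≠ VNP` is NOT proved and nothing here bears on it.

## References
* [MediniShpilka2021] D. Medini, A. Shpilka, CCC 2021, LIPIcs 200:19 = arXiv:2102.05632: Cor 44
  (p.19:14; = arXiv ‹Cor 1.27› p0009.txt:L4-5), Def 3 / Def 12 (`Σ^{[s]}Π^{[d]}`, `ΣΠΣ`), §1.2.3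
  (p.19:13 "`T_{s,d}^{GLaff_n} ⊂ Σ^{[s]}Π^{[d]}Σ`"), Obs 18 (= arXiv Obs 1.14).
* J. Heintz, C.-P. Schnorr, *Testing polynomials which are easy to compute*, STOC 1980, Thm. 4.4
  (coefficient-cover engine, tree `CoeffCover.exists_hittingSet`).
-/

noncomputable section

open MvPolynomial

namespace Literature.Computability.AlgebraicComplexity

namespace MS2021

section Inclusion

variable {K : Type*} [Field K] {n s d : ℕ}

/-- **`(Σ^{[s]}Π^{[d]})^{GLaff_n} ⊆ Σ^{[s]}Π^{[d+1]}Σ`:** a member `g(Ax+b)` of `sparseAffOrbits n s d`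
(`g` with `≤ s` monomials, degree `≤ d`) is computed by a `Σ^{[s]}Π^{[d+1]}Σ` circuit (one product
gate per monomial: a slot for the coefficient and `≤ d` affine forms) — the tree's
`MS2021.isSPS_aeval_affine` transported along `affSubst_eq_aeval_rename`.
[cite: MediniShpilka2021, §1.2.3 (CCC p.19:13 "Clearly, T_{s,d}^{GLaff_n(F)} ⊂ Σ^{[s]}Π^{[d]}Σ"; arXiv p0008.txt:L55) and Cor 44 (p.19:14)] -/
theorem isSPS_of_mem_sparseAffOrbits {f : MvPolynomial (Fin n) K}
    (hf : f ∈ sparseAffOrbits (K := K) n s d) : IsSPS s (d + 1) f := by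
  classical
  obtain ⟨m, g, hgs, hgd, h, A, b, -, rfl⟩ := hf
  rw [affSubst_eq_aeval_rename]
  have hs' : (rename (Fin.castLE h) g).support.card ≤ s := by
    rw [support_rename_of_injective (Fin.castLE_injective h)]
    exact Finset.card_image_le.trans hgs
  have hd' : (rename (Fin.castLE h) g).totalDegree ≤ d := (totalDegree_rename_le _ _).trans hgd
  have key := isSPS_aeval_affine (n := n) (rename (Fin.castLE h) g) hs' hd'
    (fun i o => o.elim (b i) fun j => A i j)
  have hφ : (fun i : Fin n => ∑ j : Fin n, C (A i j) * X j + C (b i)) =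
      fun i : Fin n => C ((fun o : Option (Fin n) => o.elim (b i) fun j => A i j) none) +
        ∑ l : Fin n, C ((fun o : Option (Fin n) => o.elim (b i) fun j => A i j) (some l)) * X l := by
    funext i
    simp only [Option.elim]
    rw [add_comm]
  rw [hφ]
  exact key

end Inclusion

/-- The numerical form of the coefficient-cover bound: for `n ≥ 2`, `d ≥ 1`,
`s·((d+1)(n+1))·(log₂((2d)ⁿ(d+1)+1)+1)+1 ≤ (nd)^{12(⌊log₂ s⌋+1)} + 12` (via `s < 2^{⌊log₂ s⌋+1}`,
`d+1 ≤ nd`, `n+1 ≤ (nd)²`, `log₂((2d)ⁿ(d+1)+1)+1 ≤ 2d(n+1)+1 ≤ (nd)⁴`).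
[cite: MediniShpilka2021, Cor 44 ("`|H| = (nd)^{O(log s)}`", CCC p.19:14)] -/
theorem cor44_coeffCover_bound {n d s : ℕ} (hn : 2 ≤ n) (hd : 1 ≤ d) :
    s * ((d + 1) * (n + 1)) * (Nat.log 2 ((2 * d) ^ n * (d + 1) + 1) + 1) + 1 ≤
      (n * d) ^ (12 * (Nat.log 2 s + 1)) + 12 := by
  set x := n * d with hx
  set L := Nat.log 2 s with hL
  have hx2 : 2 ≤ x := by rw [hx]; nlinarith
  -- `s ≤ x^{L+1}`
  have h1 : s ≤ x ^ (L + 1) :=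
    (Nat.lt_pow_succ_log_self one_lt_two s).le.trans (Nat.pow_le_pow_left hx2 _)
  -- `(d+1)(n+1) ≤ x³`
  have h2 : (d + 1) * (n + 1) ≤ x ^ 3 := by
    have hd1 : d + 1 ≤ x := by rw [hx]; nlinarith
    have hn1 : n + 1 ≤ x ^ 2 := by rw [hx]; nlinarith
    calc (d + 1) * (n + 1) ≤ x * x ^ 2 := Nat.mul_le_mul hd1 hn1
      _ = x ^ 3 := by ring
  -- the logarithm: `(2d)^n (d+1) + 1 < 2^{2d(n+1)+1}`
  have h3 : Nat.log 2 ((2 * d) ^ n * (d + 1) + 1) + 1 ≤ x ^ 4 := by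
    have h2d : 2 * d ≤ 2 ^ (2 * d) := (Nat.lt_two_pow_self).le
    have hY : (2 * d) ^ n * (d + 1) + 1 < 2 ^ (2 * d * (n + 1) + 1) := by
      have hA : (2 * d) ^ n * (d + 1) ≤ 2 ^ (2 * d * (n + 1)) := by
        calc (2 * d) ^ n * (d + 1) ≤ (2 * d) ^ n * (2 * d) :=
              Nat.mul_le_mul_left _ (by omega)
          _ = (2 * d) ^ (n + 1) := by ring
          _ ≤ (2 ^ (2 * d)) ^ (n + 1) := Nat.pow_le_pow_left h2d _
          _ = 2 ^ (2 * d * (n + 1)) := by rw [← pow_mul]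
      have hB : 1 < 2 ^ (2 * d * (n + 1)) := Nat.one_lt_two_pow (by positivity)
      rw [pow_succ]
      omega
    have hlog : Nat.log 2 ((2 * d) ^ n * (d + 1) + 1) < 2 * d * (n + 1) + 1 :=
      (Nat.log_lt_iff_lt_pow one_lt_two (by omega)).2 hY
    have h4x : 2 * d * (n + 1) + 1 ≤ x ^ 4 := by
      have : 2 * d * (n + 1) ≤ 4 * x := by rw [hx]; nlinarith
      have hx3 : 8 ≤ x ^ 3 := by nlinarith [Nat.pow_le_pow_left hx2 3]
      have : x ^ 4 = x * x ^ 3 := by ring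
      nlinarith
    omega
  -- assemble
  have hmain : s * ((d + 1) * (n + 1)) * (Nat.log 2 ((2 * d) ^ n * (d + 1) + 1) + 1) ≤
      x ^ (L + 8) := by
    calc s * ((d + 1) * (n + 1)) * (Nat.log 2 ((2 * d) ^ n * (d + 1) + 1) + 1)
        ≤ x ^ (L + 1) * x ^ 3 * x ^ 4 := Nat.mul_le_mul (Nat.mul_le_mul h1 h2) h3
      _ = x ^ (L + 8) := by ring
  have hpow : x ^ (L + 8) ≤ x ^ (12 * (L + 1)) :=
    Nat.pow_le_pow_right (by omega) (by omega)
  omega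

end MS2021

/-! ### The discharge -/

section Cor44

open MS2021 HittingSets

/-- **MS Cor 44 holds (as typed: existence and size).** "For any integers `s, d, n`, there exists an
[explicit] hitting set `H ⊂ F^n`, of size `|H| = (nd)^{O(log s)}`, such that `H` hits every nonzero
polynomial `f ∈ (Σ^{[s]}Π^{[d]})^{GLaff_n(F)}`. If `|F| ≤ n·d` then we let `H` be defined over an
extension field `K` of `F` of size `|K| > n·d`." — with `c = 12`: for `|F| > n·d` (or `F` infinite),
`n ≥ 2`, `d ≥ 1`: coefficient cover for `Σ^{[s]}Π^{[d+1]}Σ` on a grid of size `2d`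
(`SPSCoeff.exists_hittingSet_isSPS`), containing the class by `isSPS_of_mem_sparseAffOrbits`, size by
`cor44_coeffCover_bound`; `n = 1`: any `d+1` points (identity generator, Obs 18); `d = 0` / `n = 0`:
one point. DISCLOSED DEVIATION from the printed route (Thm 43 + Obs 18, the tree's edge
`MS2021_cor_44_of_thm_43`): existence via coefficient cover.
[cite: MediniShpilka2021, Cor 44 (CCC p.19:14; = arXiv ‹Cor 1.27› p0009.txt:L4-5)] -/
theorem MS2021_cor_44_holds : MS2021_cor_44 := by
  classical
  refine ⟨12, fun K _ s d n hK => ?_⟩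
  -- the small rows, identity generator on a grid `W^n`
  have small : ∀ (W : Finset K) (r : ℕ), (∀ (j : Fin n) (v : Fin n),
      degreeOf v (X j : MvPolynomial (Fin n) K) ≤ r) → d * r < W.card →
      W.card ^ n ≤ (n * d) ^ (12 * (Nat.log 2 s + 1)) + 12 →
      ∃ H : Finset (Fin n → K), H.card ≤ (n * d) ^ (12 * (Nat.log 2 s + 1)) + 12 ∧
        IsHittingSetFor (↑H) (sparseAffOrbits (K := K) n s d) := by
    intro W r hr hW hcard
    exact ⟨(Fintype.piFinset fun _ : Fin n => W).image fun (x : Fin n → K) (j : Fin n) =>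
        eval x (X j : MvPolynomial (Fin n) K),
      ((card_image_piFinset_le _ W).trans (by rwa [Fintype.card_fin])),
      isHittingSetFor_image_piFinset (isGeneratorFor_X _) (D := d) (r := r)
        (fun f hf => totalDegree_le_of_mem_sparseAffOrbits hf) hr W hW⟩
  have hdegX : ∀ (j : Fin n) (v : Fin n), degreeOf v (X j : MvPolynomial (Fin n) K) ≤ 1 :=
    fun j v => (degreeOf_le_totalDegree _ _).trans (totalDegree_X (R := K) j).le
  rcases Nat.eq_zero_or_pos d with rfl | hd
  · -- `d = 0`: constants; the grid `{0}^n`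
    exact small {0} 1 hdegX (by simp) (by simp)
  rcases Nat.eq_zero_or_pos n with rfl | hn
  · -- `n = 0`: the one-point grid
    exact small {0} 0 (fun j => j.elim0) (by simp) (by simp)
  by_cases hn1 : n = 1
  · -- `n = 1`: any `d + 1` points
    subst hn1
    obtain ⟨W, hW⟩ : ∃ W : Finset K, W.card = d + 1 :=
      exists_finset_card_eq (K := K) (d + 1) (hK.imp id fun h => by omega)
    refine small W 1 hdegX (by rw [hW]; omega) ?_
    rw [hW, pow_one, one_mul]
    have : d ≤ d ^ (12 * (Nat.log 2 s + 1)) := Nat.le_self_pow (by omega) d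
    omega
  -- main row `n ≥ 2`: coefficient cover for `Σ^{[s]}Π^{[d+1]}Σ` on a grid of size `2d`
  have hn2 : 2 ≤ n := by omega
  obtain ⟨S, hS⟩ : ∃ S : Finset K, S.card = 2 * d :=
    exists_finset_card_eq (K := K) (2 * d) (hK.imp id fun h =>
      ((Nat.mul_le_mul_right d hn2).trans h.le))
  have hS1 : S.Nonempty := Finset.card_pos.1 (by rw [hS]; omega)
  obtain ⟨H, -, hcard, hhit⟩ :=
    SPSCoeff.exists_hittingSet_isSPS (K := K) n s (d + 1) d S hS1 hS.ge
  refine ⟨H, hcard.trans ?_, fun f hf hf0 =>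
    hhit f (isSPS_of_mem_sparseAffOrbits hf) (totalDegree_le_of_mem_sparseAffOrbits hf) hf0⟩
  rw [hS]
  exact cor44_coeffCover_bound hn2 hd

/-- **MS Cor 44 by the PRINTED route** ("(cor:hs-sparse) follows immediately from (thm:PITSINV)
and (obsHitSetGen)", arXiv p0035:L5): the tree's edge `MS2021_cor_44_of_thm_43` (uniform SV
generator of independence `⌊log₂ s⌋ + 2` + Obs 18, `MS21UniformSVGenerator.lean`) applied to
`MS2021_thm_43_holds` (`MS21SparseOrbitHittingProofs.lean`). Same named fact, second proof.
[cite: MediniShpilka2021, Cor 44 (CCC p.19:14; = arXiv ‹Cor 1.27› p0009.txt:L4-5; proof sentence p0035.txt:L5)] -/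
theorem MS2021_cor_44_holds_printed : MS2021_cor_44 :=
  MS2021_cor_44_of_thm_43 MS2021_thm_43_holds

end Cor44

end Literature.Computability.AlgebraicComplexity

end
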